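import Summits.QuantumFields.BalabanUV.Beta.GAN24.FineReadoutCauchyDecLegs
import Summits.QuantumFields.BalabanUV.Beta.GAN24.FineReadoutCauchyHolds
import Summits.QuantumFields.BalabanUV.Beta.GAN24.SandwichDecimate

/-!
# `BalabanUV.Beta.GAN24.FineReadoutCauchyDecThree` — binder row G-an2-4 / (CONV-C), S-slot, road «S3»: «(N1-Cauchy)» IN THE FORMS THE DIFF
# ROWS CONSUME, part 3 — UNCONDITIONAL AT `d = 3`, EVERY `Lc ≥ 2` (generic leaf «N1-CAUCHY-DEC*»; b2b-balaban-gan24-formalise-leaf-19, gen 15;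
# parts 1–2 = `GAN24/FineReadoutCauchyDec` / `GAN24/FineReadoutCauchyDecLegs`)

NOT IN PRINT; OUR PROOF ATTEMPT.  HONEST FRAMING (cell contract, verbatim): «discharging `BetaPertH` makes Bałaban's UV stability
UNCONDITIONAL — a real constructive-QFT result; it is NOT the continuum limit and NOT the Clay problem.»  HONEST DEPENDENCY (verbatim):
«continuum YM on T⁴ ⇐ BetaPertH ∧ nine spine estimates (0/9 proved); BetaPertH ⇐ (D1) ∧ (D4) ∧ CAP+tail; G-an2-4 gates asym, D1 and
NE2/3/4.»  [folklore] two-line corollaries: the hypothesis `hC` of part 2 (the owner's CELL-MEAN statement of «(N1-Cauchy)»,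
`HOME/b2b-balaban-gan24-p1/N1-CAUCHY-SPEC.md` §1) DISCHARGED BY NAME by the T-N1C team's TREE theorem
`FineReadoutCauchyHolds.exists_wH_cellMean_cauchy` (holder leaf-17; parts by leaf-16 / leaf-01 / leaf-13 / leaf-17) — no hypothesis left.
No cited fact, no `def`, no wall binder.  Moves no row (ref2 (h)): these are LEG inputs of the DIFF rows dW/dV/dL, not rows; discharges NOTHING of
«E3SupRate»/«E3Shape», of (hS, hSall) by itself; NOT BetaPertH, NOT continuum, NOT Clay.

## What is proved (`d = 3`, every `Lc ≥ 2`, NO hypothesis; one `(c′, θ′, κ′)` per statement, `0 ≤ c′`, `0 ≤ θ′ < 1`, `0 < κ′`)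
* `dec_cauchy_three` (D): `|Σ_{i ∈ legSet 3 Lc a} legW 3 Lc a·H̃_{Lc^(n+2)}(legPt Lc a z i) − H̃_{Lc^(n+1)}(z)| ≤ c′·θ′^n·e^{−κ′|quo_{Lc^(n+1)} z|₁}`, every leg type `a`
  and `decLeg_cauchy_three` — the same in leaf-04-g20's `SandwichDecimate.decLeg` currency = LITERALLY the ROW-dL holder's hypothesis `hN1Cdec`
  (leaf-11-g15, CLAIMS l.5446);
* `sample_cauchy_three` (P); `blockSample_cauchy_three` (S) in the dW row's LITERAL coupling shape (leaf-15-g14's `hNC`, CLAIMS l.5774: index `j`,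
  weight `quo (Lc^(j+1+1)) z`);
* `decLegs_three` / `sampleLegs_three`: the three leg differences of `TaylorSandwich.sandwich_bound` (vertex/right `wH`, left `GamΦ`) in
  `StencilSlotE3HLeg.legs_three` currency, ROW indexing (member `n+2` at `Lc^(n+1+1)`, member `n+3` at `Lc^(n+1+1+1)`, rate `θ′^(n+1)`),
  decimated resp. block-sampled.
Unit `b2b-balaban-gan24-formalise-leaf-19` (gen 15), 2026-08-20.
-/

noncomputable section

open Finset
open scoped BigOperators
open Literature.MathematicalPhysics.QuantumFieldTheory
open Literature.MathematicalPhysics.QuantumFieldTheory.Balaban1983to89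
open Literature.MathematicalPhysics.QuantumFieldTheory.Balaban1983to89.Beta
open Literature.MathematicalPhysics.QuantumFieldTheory.LatticeForm (quo)
open B12Sec2to5 (l1)
open AffineAveraging (box toSite)
open KernelSpecInstance (wH)
open KKTFluctuationKernel (GamΦ)
open OneStepResolventKernel (Fib)
open OneStepKernelFamily (legSet legPt legW)
open Summit.QuantumFields.BalabanUV.Beta.GAN24.FineReadoutCauchyHolds (exists_wH_cellMean_cauchy)
open Summit.QuantumFields.BalabanUV.Beta.GAN24.SandwichDecimate (decLeg decLeg_apply)
open Summit.QuantumFields.BalabanUV.Beta.GAN24.FineReadoutCauchyDecLegs (exists_sample_cauchy_of_cellMean exists_dec_cauchy_of_cellMean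
  exists_blockSample_cauchy_of_cellMean decLegs_three_of_cellMean sampleLegs_three_of_cellMean quo_pow_succ_eq)

namespace Summit.QuantumFields.BalabanUV.Beta.GAN24.FineReadoutCauchyDecThree

variable {Lc : ℕ} [NeZero Lc]

/-- **(D) UNCONDITIONAL AT `d = 3`**: the `dec Lc` block-contour mean of the next level's normalised minimiser column (any leg type `a`) against this
level's column — `n`-geometric with block-ℓ¹ decay, every `Lc ≥ 2`, NO hypothesis. [folklore] -/
theorem dec_cauchy_three (hLc : 2 ≤ Lc) :
    ∃ c' θ' κ' : ℝ, 0 ≤ c' ∧ 0 ≤ θ' ∧ θ' < 1 ∧ 0 < κ' ∧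
      ∀ (n : ℕ) (κ l : Fin (3 + 1)) (z : Fin (3 + 1) → ℤ) (a : Fib 3),
        |∑ i ∈ legSet 3 Lc a, legW 3 Lc a * (((Lc : ℝ) ^ (n + 2)) ^ (3 + 2) * wH (N := Lc ^ (n + 2)) κ l (legPt Lc a z i)) -
            ((Lc : ℝ) ^ (n + 1)) ^ (3 + 2) * wH (N := Lc ^ (n + 1)) κ l z|
          ≤ c' * θ' ^ n * Real.exp (-κ' * l1 (quo (Lc ^ (n + 1)) z)) := by
  obtain ⟨c, θ, κ₁, hc, hθ0, hθ1, hκ₁, hC⟩ := exists_wH_cellMean_cauchy Lc hLc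
  exact exists_dec_cauchy_of_cellMean (d := 3) hLc hc hθ0 hθ1 hκ₁ hC

/-- **(D) IN `decLeg` CURRENCY, UNCONDITIONAL AT `d = 3`** — LITERALLY the ROW-dL holder's hypothesis `hN1Cdec` (leaf-11-g15, CLAIMS l.5446) over
leaf-04-g20's `SandwichDecimate.decLeg` (p207993): `|decLeg Lc H̃_{Lc^(n+2)} κ z − H̃_{Lc^(n+1)} κ z| ≤ c′·θ′^n·e^{−κ′|quo_{Lc^(n+1)} z|₁}`, NO hypothesis. [folklore] -/
theorem decLeg_cauchy_three (hLc : 2 ≤ Lc) :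
    ∃ c' θ' κ' : ℝ, 0 ≤ c' ∧ 0 ≤ θ' ∧ θ' < 1 ∧ 0 < κ' ∧
      ∀ (n : ℕ) (κ l : Fin (3 + 1)) (z : Fin (3 + 1) → ℤ),
        |decLeg Lc (fun κ z => ((Lc : ℝ) ^ (n + 2)) ^ (3 + 2) * wH (N := Lc ^ (n + 2)) κ l z) κ z -
            ((Lc : ℝ) ^ (n + 1)) ^ (3 + 2) * wH (N := Lc ^ (n + 1)) κ l z|
          ≤ c' * θ' ^ n * Real.exp (-κ' * l1 (quo (Lc ^ (n + 1)) z)) := by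
  obtain ⟨c', θ', κ', h0, h1, h2, h3, hD⟩ := dec_cauchy_three (Lc := Lc) hLc
  refine ⟨c', θ', κ', h0, h1, h2, h3, fun n κ l z => ?_⟩
  rw [decLeg_apply]
  exact hD n κ l z (Sum.inl κ)

/-- **(P) UNCONDITIONAL AT `d = 3`**: every sample `H̃_{Lc^(n+2)}(Lc•z + v)`, `|v|₁ ≤ 2(3+1)·Lc`, against `H̃_{Lc^(n+1)}(z)`. [folklore] -/
theorem sample_cauchy_three (hLc : 2 ≤ Lc) :
    ∃ c' θ' κ' : ℝ, 0 ≤ c' ∧ 0 ≤ θ' ∧ θ' < 1 ∧ 0 < κ' ∧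
      ∀ (n : ℕ) (κ l : Fin (3 + 1)) (z v : Fin (3 + 1) → ℤ), l1 v ≤ 2 * (3 + 1) * Lc →
        |((Lc : ℝ) ^ (n + 2)) ^ (3 + 2) * wH (N := Lc ^ (n + 2)) κ l ((Lc : ℤ) • z + v) -
            ((Lc : ℝ) ^ (n + 1)) ^ (3 + 2) * wH (N := Lc ^ (n + 1)) κ l z|
          ≤ c' * θ' ^ n * Real.exp (-κ' * l1 (quo (Lc ^ (n + 1)) z)) := by
  obtain ⟨c, θ, κ₁, hc, hθ0, hθ1, hκ₁, hC⟩ := exists_wH_cellMean_cauchy Lc hLc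
  exact exists_sample_cauchy_of_cellMean (d := 3) hLc hc hθ0 hθ1 hκ₁ hC

/-- **(S) UNCONDITIONAL AT `d = 3`** — every fine site of the next level against its `Lc`-block at this level, IN THE dW ROW's LITERAL
COUPLING SHAPE (leaf-15-g14's hypothesis `hNC` of `TaylorRowDW.rowDW_of_cauchy`, CLAIMS l.5774: index `j`, members `Lc^(j+1)` / `Lc^(j+1+1)`,
weight in the BIG member's block label `quo (Lc^(j+1+1)) z`). [folklore] -/
theorem blockSample_cauchy_three (hLc : 2 ≤ Lc) :
    ∃ c' θ' κ' : ℝ, 0 ≤ c' ∧ 0 ≤ θ' ∧ θ' < 1 ∧ 0 < κ' ∧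
      ∀ (j : ℕ) (κ l : Fin (3 + 1)) (z : Fin (3 + 1) → ℤ),
        |((Lc : ℝ) ^ (j + 1 + 1)) ^ (3 + 2) * wH (N := Lc ^ (j + 1 + 1)) κ l z -
            ((Lc : ℝ) ^ (j + 1)) ^ (3 + 2) * wH (N := Lc ^ (j + 1)) κ l (quo Lc z)|
          ≤ c' * θ' ^ j * Real.exp (-κ' * l1 (quo (Lc ^ (j + 1 + 1)) z)) := by
  obtain ⟨c, θ, κ₁, hc, hθ0, hθ1, hκ₁, hC⟩ := exists_wH_cellMean_cauchy Lc hLc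
  obtain ⟨c', θ', κ', h0, h1, h2, h3, hS⟩ := exists_blockSample_cauchy_of_cellMean (d := 3) hLc hc hθ0 hθ1 hκ₁ hC
  refine ⟨c', θ', κ', h0, h1, h2, h3, fun j κ l z => ?_⟩
  have h := hS j κ l z
  rw [← quo_pow_succ_eq, show j + 2 = j + 1 + 1 from rfl] at h
  exact h

/-- **THE THREE DECIMATED LEG DIFFERENCES, UNCONDITIONAL AT `d = 3`** (ROW indexing, `StencilSlotE3HLeg.legs_three` currency):
member `n+3`'s `Lc`-decimated legs against member `n+2`'s — vertex/right (`wH`) and left (`GamΦ`). [folklore] -/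
theorem decLegs_three (hLc : 2 ≤ Lc) :
    ∃ c' θ' κ' : ℝ, 0 ≤ c' ∧ 0 ≤ θ' ∧ θ' < 1 ∧ 0 < κ' ∧
      (∀ (n : ℕ) (k l : Fin (3 + 1)) (u u' : Fin (3 + 1) → ℤ),
        |∑ i ∈ legSet 3 Lc (Sum.inl k), legW 3 Lc (Sum.inl k) *
              (((Lc : ℝ) ^ (n + 1 + 1 + 1)) ^ (3 + 2) *
                wH (N := Lc ^ (n + 1 + 1 + 1)) k l (legPt Lc (Sum.inl k) u i - (((Lc ^ (n + 1 + 1 + 1) : ℕ) : ℤ)) • u')) -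
            ((Lc : ℝ) ^ (n + 1 + 1)) ^ (3 + 2) * wH (N := Lc ^ (n + 1 + 1)) k l (u - (((Lc ^ (n + 1 + 1) : ℕ) : ℤ)) • u')|
          ≤ c' * θ' ^ (n + 1) * Real.exp (-κ' * l1 (quo (Lc ^ (n + 1 + 1)) u - u'))) ∧
      (∀ (n : ℕ) (α l : Fin (3 + 1)) (x' w : Fin (3 + 1) → ℤ),
        |∑ i ∈ legSet 3 Lc (Sum.inl l), legW 3 Lc (Sum.inl l) *
              (((Lc : ℝ) ^ (n + 1 + 1 + 1)) ^ (3 + 2) * GamΦ (N := Lc ^ (n + 1 + 1 + 1)) α x' l (legPt Lc (Sum.inl l) w i)) -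
            ((Lc : ℝ) ^ (n + 1 + 1)) ^ (3 + 2) * GamΦ (N := Lc ^ (n + 1 + 1)) α x' l w|
          ≤ c' * θ' ^ (n + 1) * Real.exp (-κ' * l1 (x' - quo (Lc ^ (n + 1 + 1)) w))) := by
  obtain ⟨c, θ, κ₁, hc, hθ0, hθ1, hκ₁, hC⟩ := exists_wH_cellMean_cauchy Lc hLc
  exact decLegs_three_of_cellMean hLc hc hθ0 hθ1 hκ₁ hC

/-- **THE THREE BLOCK-SAMPLED LEG DIFFERENCES, UNCONDITIONAL AT `d = 3`** (ROW indexing; the dW row's three couplings, leaf-15-g14 CLAIMS l.5425):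
member `n+3`'s legs at the fine site against member `n+2`'s at its `Lc`-block. [folklore] -/
theorem sampleLegs_three (hLc : 2 ≤ Lc) :
    ∃ c' θ' κ' : ℝ, 0 ≤ c' ∧ 0 ≤ θ' ∧ θ' < 1 ∧ 0 < κ' ∧
      (∀ (n : ℕ) (k l : Fin (3 + 1)) (u u' : Fin (3 + 1) → ℤ),
        |((Lc : ℝ) ^ (n + 1 + 1 + 1)) ^ (3 + 2) *
              wH (N := Lc ^ (n + 1 + 1 + 1)) k l (u - (((Lc ^ (n + 1 + 1 + 1) : ℕ) : ℤ)) • u') -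
            ((Lc : ℝ) ^ (n + 1 + 1)) ^ (3 + 2) *
              wH (N := Lc ^ (n + 1 + 1)) k l (quo Lc u - (((Lc ^ (n + 1 + 1) : ℕ) : ℤ)) • u')|
          ≤ c' * θ' ^ (n + 1) * Real.exp (-κ' * l1 (quo (Lc ^ (n + 1 + 1 + 1)) u - u'))) ∧
      (∀ (n : ℕ) (α l : Fin (3 + 1)) (x' w : Fin (3 + 1) → ℤ),
        |((Lc : ℝ) ^ (n + 1 + 1 + 1)) ^ (3 + 2) * GamΦ (N := Lc ^ (n + 1 + 1 + 1)) α x' l w -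
            ((Lc : ℝ) ^ (n + 1 + 1)) ^ (3 + 2) * GamΦ (N := Lc ^ (n + 1 + 1)) α x' l (quo Lc w)|
          ≤ c' * θ' ^ (n + 1) * Real.exp (-κ' * l1 (x' - quo (Lc ^ (n + 1 + 1 + 1)) w))) := by
  obtain ⟨c, θ, κ₁, hc, hθ0, hθ1, hκ₁, hC⟩ := exists_wH_cellMean_cauchy Lc hLc
  exact sampleLegs_three_of_cellMean hLc hc hθ0 hθ1 hκ₁ hC

end Summit.QuantumFields.BalabanUV.Beta.GAN24.FineReadoutCauchyDecThree

end
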